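import Summits.Ventures.Crystal3D.Theorems.StickyWulffConstantPolycrystalWulffBoundInclinedLamellarSections
import Summits.Ventures.Crystal3D.Theorems.StickyWulffConstantPolycrystalWulffBoundMinkowskiUpper
import Summits.Ventures.Crystal3D.Theorems.StickyWulffConstantTextureLiminfPolytopeCalculus
import Summits.Ventures.Crystal3D.Theorems.StickyWulffConstantTextureLiminfTentFrameWulff
import HarnessLib

/-!
# TB-D assembly, part 1a: PIECES of a piecewise-convex texture — bodies, facets, contacts, separating planes, and the two PAIR bounds
# (lane T, crux `TextureLiminfV5`, stmt-Ventures-23912; design memo TB-D-0 §4 "energy localisation")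

HONEST FRAMING. Venture `Summits/Ventures/Crystal3D` (cell `crystal3d-full`), route `route-Ventures-StickyWulffConstant`, helper `--supports` the
law-v5 crux `TextureLiminfV5` (stmt-Ventures-23912).  Pure continuum bookkeeping on top of the P-lane's facet calculus (…PolycrystalWulffBound
{MergingCalculus, InclinedLamellarSections, MinkowskiUpper, FacetAreaSymm}), using the LANDED `stub_polytopeCalculus`
(…TextureLiminfPolytopeCalculus: `per_union_two_polytopes`), hence unconditional; census-free, standard axioms; nothing about any cover or mesh; F-C1 not moved.  Consumed by
`…TextureBuildPieceEnergy.energy_le_pieceLedger` (part 1b).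

* bodies: `wulffOf A` and `wallBody m` are origin-symmetric compact convex bodies `∋ 0` (`neg_wulffOf`, `isCompact_wulffOf`, `convex_wulffOf`,
  `neg_wallBody`, `isCompact_wallBody`, `convex_wallBody`, `zero_mem_wallBody`; `supportFn_nonneg`, `facetArea_nonneg`);
* pieces `P = polytope H`: `closure_polytope_subset_halfspaces`, `exists_facet_of_mem_closure` (a boundary point lies on a facet plane),
  **`closure_inter_closure_subset_facets`** (the contact `cl P ∩ cl P'` of disjoint pieces lies on the facets of `P`), `eq_or_eq_neg_of_plane_eq`
  (equal planes ⇒ unit normals agree up to sign), **`exists_separating_plane`** (Hahn–Banach: `cl P ∩ cl P' ⊆ {⟪ν,x⟫ = b}`, `‖ν‖ = 1`);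
* **`per_add_per_sub_per_union_pair`** — clause (B) with `k = 2`: `2ι_K(P, P') = (h_K(ν) + h_K(−ν))·facetArea (cl P ∩ cl P') ν`;
* the PAIR BOUNDS for an origin-symmetric body: **`iota_pair_le_facetSum`** (W) `ι_D(P,P') ≤ Σ_{p ∈ H} h_D(p.1)·facetArea(F_p ∩ cl P')` and
  **`facetSum_le_iota_pair`** (F) `Σ_{p ∈ H} h_K(p.1)·facetArea(F_p ∩ cl P') ≤ ι_K(P,P')` (pairwise distinct facet planes) — `F_p = cl P ∩ {⟪p.1,x⟫ = p.2}`;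
  on a facet plane other than the separating plane the contact has area `0` (`facetArea_eq_zero_of_subset_two_planes`), on it `ν = ±p.1`.
-/

noncomputable section

namespace Summit.Ventures.Crystal3D.Cruxes.TextureLiminf.TexShadow

open Summit.Ventures.Crystal3D Summit.Ventures.Crystal3D.Theorems MeasureTheory Set
open scoped InnerProductSpace
open Literature.MathematicalPhysics.StatisticalMechanics (isCompact_fccWulffBody)
open Literature.Analysis.Convexity (convex_openHPolytope isOpen_openHPolytope sSup_inner_image_nonneg)
open Summit.Ventures.Crystal3D.TentCertificate (toRef wulffOf_eq_image)

/-! ### The bodies: `wulffOf A` and `wallBody m` are origin-symmetric compact convex bodies containing `0` -/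

/-- `phiB` is even. -/
theorem phiB_neg (ν : E3) : phiB (-ν) = phiB ν := by
  unfold phiB
  simp only [inner_neg_right, abs_neg]

/-- `wulffOf A` is origin-symmetric. -/
theorem neg_wulffOf (A : E3 ≃ₗᵢ[ℝ] E3) : -wulffOf A = wulffOf A := by
  ext y
  simp only [wulffOf, Set.mem_neg, Set.mem_setOf_eq]
  constructor
  · intro h ν
    have h' := h (-ν)
    rwa [inner_neg_left, inner_neg_right, neg_neg, map_neg, phiB_neg] at h'
  · intro h ν
    have h' := h (-ν)
    rw [inner_neg_right, map_neg, phiB_neg] at h'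
    rwa [inner_neg_left]

/-- `wulffOf A` is compact. -/
theorem isCompact_wulffOf (A : E3 ≃ₗᵢ[ℝ] E3) : IsCompact (wulffOf A) := by
  rw [wulffOf_eq_image]
  exact isCompact_fccWulffBody.image (toRef.trans A).continuous

/-- `wulffOf A` is convex. -/
theorem convex_wulffOf (A : E3 ≃ₗᵢ[ℝ] E3) : Convex ℝ (wulffOf A) := by
  intro x hx y hy a b ha hb hab
  simp only [wulffOf, Set.mem_setOf_eq] at hx hy ⊢
  intro ν
  rw [inner_add_left, real_inner_smul_left, real_inner_smul_left]
  calc a * ⟪x, ν⟫_ℝ + b * ⟪y, ν⟫_ℝ ≤ a * phiB (A.symm ν) + b * phiB (A.symm ν) :=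
        add_le_add (mul_le_mul_of_nonneg_left (hx ν) ha) (mul_le_mul_of_nonneg_left (hy ν) hb)
    _ = phiB (A.symm ν) := by rw [← add_mul, hab, one_mul]

/-- `wallBody m` is origin-symmetric. -/
theorem neg_wallBody (m : E3) : -wallBody m = wallBody m := by
  ext y
  simp only [wallBody, Set.mem_neg, Set.mem_setOf_eq, norm_neg, inner_neg_left, neg_eq_zero]

/-- `wallBody m` is compact. -/
theorem isCompact_wallBody (m : E3) : IsCompact (wallBody m) := by
  refine Metric.isCompact_of_isClosed_isBounded
    ((isClosed_le continuous_norm continuous_const).inter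
      (isClosed_eq (continuous_id.inner continuous_const) continuous_const))
    ((Metric.isBounded_closedBall (x := (0 : E3)) (r := 1)).subset ?_)
  intro y hy
  rw [Metric.mem_closedBall, dist_zero_right]
  exact hy.1

/-- `wallBody m` is convex. -/
theorem convex_wallBody (m : E3) : Convex ℝ (wallBody m) := by
  intro x hx y hy a b ha hb hab
  simp only [wallBody, Set.mem_setOf_eq] at hx hy ⊢
  refine ⟨?_, ?_⟩
  · calc ‖a • x + b • y‖ ≤ ‖a • x‖ + ‖b • y‖ := norm_add_le _ _
      _ ≤ a * 1 + b * 1 := by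
          rw [norm_smul, norm_smul, Real.norm_eq_abs, Real.norm_eq_abs, abs_of_nonneg ha, abs_of_nonneg hb]
          exact add_le_add (mul_le_mul_of_nonneg_left hx.1 ha) (mul_le_mul_of_nonneg_left hy.1 hb)
      _ = 1 := by rw [mul_one, mul_one, hab]
  · rw [inner_add_left, real_inner_smul_left, real_inner_smul_left, hx.2, hy.2, mul_zero, mul_zero, add_zero]

/-- `0 ∈ wallBody m`. -/
theorem zero_mem_wallBody (m : E3) : (0 : E3) ∈ wallBody m := by
  simp [wallBody]

/-- The support function of a compact body containing the origin is nonnegative. -/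
theorem supportFn_nonneg {K : Set E3} (hK : IsCompact K) (h0 : (0 : E3) ∈ K) (ν : E3) : 0 ≤ supportFn K ν := by
  unfold supportFn
  exact sSup_inner_image_nonneg hK h0 ν

/-- `facetArea ≥ 0`. -/
theorem facetArea_nonneg (F : Set E3) (ν : E3) : 0 ≤ facetArea F ν := ENNReal.toReal_nonneg

/-! ### Pieces: closures, facets, contacts, separating planes -/

/-- The closure of an open `H`-polytope satisfies the closed constraints. -/
theorem closure_polytope_subset_halfspaces (H : Finset (E3 × ℝ)) :
    closure (polytope H) ⊆ ⋂ p ∈ H, {x : E3 | ⟪p.1, x⟫_ℝ ≤ p.2} := by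
  refine closure_minimal (fun x hx => ?_) (isClosed_iInter fun p => isClosed_iInter fun _ =>
    isClosed_le (continuous_const.inner continuous_id) continuous_const)
  simp only [polytope, mem_iInter, mem_setOf_eq] at hx ⊢
  exact fun p hp => (hx p hp).le

/-- A point of the closure of a piece outside the piece lies on one of its facet planes. -/
theorem exists_facet_of_mem_closure {H : Finset (E3 × ℝ)} {x : E3} (hx : x ∈ closure (polytope H))
    (hx' : x ∉ polytope H) : ∃ p ∈ H, ⟪p.1, x⟫_ℝ = p.2 := by
  by_contra hne
  simp only [not_exists, not_and] at hne
  apply hx'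
  simp only [polytope, mem_iInter, mem_setOf_eq]
  intro p hp
  have hle : ⟪p.1, x⟫_ℝ ≤ p.2 := by
    have h := closure_polytope_subset_halfspaces H hx
    simp only [mem_iInter, mem_setOf_eq] at h
    exact h p hp
  exact lt_of_le_of_ne hle (hne p hp)

/-- **Contacts lie on facets**: for disjoint pieces `P, P'`, `cl P ∩ cl P' ⊆ ⋃_{p} (cl P ∩ {⟪p.1,x⟫ = p.2}) ∩ cl P'`. -/
theorem closure_inter_closure_subset_facets {H H' : Finset (E3 × ℝ)} (hd : Disjoint (polytope H) (polytope H')) :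
    closure (polytope H) ∩ closure (polytope H') ⊆
      ⋃ p ∈ H, closure (polytope H) ∩ {x : E3 | ⟪p.1, x⟫_ℝ = p.2} ∩ closure (polytope H') := by
  rintro x ⟨hx, hx'⟩
  have hxP : x ∉ polytope H := fun h =>
    (hd.closure_right (isOpen_openHPolytope H)).le_bot ⟨h, hx'⟩
  obtain ⟨p, hp, hpx⟩ := exists_facet_of_mem_closure hx hxP
  exact mem_iUnion₂.2 ⟨p, hp, ⟨hx, hpx⟩, hx'⟩

/-- Two planes with unit normals coincide only if the normals agree up to sign. -/
theorem eq_or_eq_neg_of_plane_eq {ν ν' : E3} {b b' : ℝ} (hν : ‖ν‖ = 1) (hν' : ‖ν'‖ = 1)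
    (h : {x : E3 | ⟪ν, x⟫_ℝ = b} = {x : E3 | ⟪ν', x⟫_ℝ = b'}) : ν' = ν ∨ ν' = -ν := by
  have hνν : ⟪ν, ν⟫_ℝ = 1 := by rw [real_inner_self_eq_norm_sq, hν, one_pow]
  have hν'ν' : ⟪ν', ν'⟫_ℝ = 1 := by rw [real_inner_self_eq_norm_sq, hν', one_pow]
  have hmem : ∀ w : E3, ⟪ν, w⟫_ℝ = 0 → ⟪ν', w⟫_ℝ = 0 := by
    intro w hw
    have h1 : b • ν ∈ {x : E3 | ⟪ν, x⟫_ℝ = b} := by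
      simp only [mem_setOf_eq, real_inner_smul_right, hνν, mul_one]
    have h2 : b • ν + w ∈ {x : E3 | ⟪ν, x⟫_ℝ = b} := by
      simp only [mem_setOf_eq, inner_add_right, real_inner_smul_right, hνν, mul_one, hw, add_zero]
    rw [h] at h1 h2
    simp only [mem_setOf_eq, inner_add_right] at h1 h2
    linarith
  set t : ℝ := ⟪ν, ν'⟫_ℝ with ht
  have hw : ⟪ν, ν' - t • ν⟫_ℝ = 0 := by
    rw [inner_sub_right, real_inner_smul_right, hνν, mul_one, ht, sub_self]
  have h3 := hmem _ hw
  rw [inner_sub_right, real_inner_smul_right, hν'ν', real_inner_comm ν ν', ← ht] at h3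
  have hn : ‖ν' - t • ν‖ ^ 2 = 1 - t * t := by
    rw [← real_inner_self_eq_norm_sq, inner_sub_left, inner_sub_right, inner_sub_right, real_inner_smul_left,
      real_inner_smul_right, real_inner_smul_left, real_inner_smul_right, hνν, hν'ν', real_inner_comm ν ν', ← ht]
    ring
  have h0 : ν' - t • ν = 0 := by
    have h4 : ‖ν' - t • ν‖ ^ 2 = 0 := by rw [hn]; linarith
    rwa [sq_eq_zero_iff, norm_eq_zero] at h4
  rw [sub_eq_zero] at h0
  have ht1 : (t - 1) * (t + 1) = 0 := by nlinarith
  rcases mul_eq_zero.1 ht1 with h5 | h5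
  · left
    rw [h0, show t = 1 by linarith, one_smul]
  · right
    rw [h0, show t = -1 by linarith, neg_one_smul]

/-- **Separating plane** of two disjoint pieces: a unit normal `ν` and a level `b` with `cl P ∩ cl P' ⊆ {⟪ν, x⟫ = b}`. -/
theorem exists_separating_plane {H H' : Finset (E3 × ℝ)} (hd : Disjoint (polytope H) (polytope H')) :
    ∃ ν : E3, ∃ b : ℝ, ‖ν‖ = 1 ∧ closure (polytope H) ∩ closure (polytope H') ⊆ {x : E3 | ⟪ν, x⟫_ℝ = b} := by
  by_cases hne : (polytope H).Nonempty ∧ (polytope H').Nonempty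
  · obtain ⟨⟨a₀, ha₀⟩, ⟨b₀, hb₀⟩⟩ := hne
    obtain ⟨f, u, hfs, hft⟩ := geometric_hahn_banach_open_open (convex_openHPolytope H) (isOpen_openHPolytope H)
      (convex_openHPolytope H') (isOpen_openHPolytope H') hd
    set v : E3 := (InnerProductSpace.toDual ℝ E3).symm f with hv
    have hfv : ∀ x, f x = ⟪v, x⟫_ℝ := fun x => by rw [hv, InnerProductSpace.toDual_symm_apply]
    have hv0 : v ≠ 0 := by
      intro h0
      have h1 := hfs a₀ ha₀
      have h2 := hft b₀ hb₀
      rw [hfv, h0, inner_zero_left] at h1 h2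
      linarith
    have hvn : 0 < ‖v‖ := norm_pos_iff.2 hv0
    refine ⟨‖v‖⁻¹ • v, ‖v‖⁻¹ * u, ?_, ?_⟩
    · rw [norm_smul, norm_inv, norm_norm, inv_mul_cancel₀ hvn.ne']
    · rintro x ⟨hx, hx'⟩
      have h1 : f x ≤ u :=
        (closure_minimal (fun y hy => (hfs y hy).le) (isClosed_le f.continuous continuous_const) :
          closure (polytope H) ⊆ {y | f y ≤ u}) hx
      have h2 : u ≤ f x :=
        (closure_minimal (fun y hy => (hft y hy).le) (isClosed_le continuous_const f.continuous) :
          closure (polytope H') ⊆ {y | u ≤ f y}) hx'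
      show ⟪‖v‖⁻¹ • v, x⟫_ℝ = ‖v‖⁻¹ * u
      rw [real_inner_smul_left, ← hfv, le_antisymm h1 h2]
  · refine ⟨EuclideanSpace.single 0 1, 0, by rw [PiLp.norm_single, norm_one], ?_⟩
    rw [not_and_or, Set.not_nonempty_iff_eq_empty, Set.not_nonempty_iff_eq_empty] at hne
    rcases hne with h | h <;> simp [h]

/-! ### Two pieces: clause (B) with `k = 2` -/

/-- **Clause (B) for two disjoint pieces** (from the landed `per_union_two_polytopes`): `per K P + per K P' − per K (P ∪ P') =
(h_K(ν) + h_K(−ν))·facetArea (cl P ∩ cl P') ν` for any separating unit normal `ν`. -/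
theorem per_add_per_sub_per_union_pair {K : Set E3} (hK : IsCompact K) (hKc : Convex ℝ K)
    (hK0 : (0 : E3) ∈ K) {H₁ H₂ : Finset (E3 × ℝ)} (hb₁ : Bornology.IsBounded (polytope H₁))
    (hb₂ : Bornology.IsBounded (polytope H₂)) (hd : Disjoint (polytope H₁) (polytope H₂)) {ν : E3} (hν : ‖ν‖ = 1)
    {b : ℝ} (hsep : closure (polytope H₁) ∩ closure (polytope H₂) ⊆ {x : E3 | ⟪ν, x⟫_ℝ = b}) :
    per K (polytope H₁) + per K (polytope H₂) - per K (polytope H₁ ∪ polytope H₂) =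
      (supportFn K ν + supportFn K (-ν)) * facetArea (closure (polytope H₁) ∩ closure (polytope H₂)) ν := by
  rw [per_union_two_polytopes K hK hKc hK0 H₁ H₂ hb₁ hb₂ hd ν hν b hsep]
  ring

/-! ### Subadditivity helpers and the two pair inequalities -/

/-- `facetArea F ≤ facetArea A + facetArea B` when `F ⊆ A ∪ B` (pieces of the closure of a bounded set). -/
theorem facetArea_le_add {F A B Q : Set E3} (hQ : Bornology.IsBounded Q) (hA : A ⊆ closure Q)
    (hB : B ⊆ closure Q) (hF : F ⊆ A ∪ B) (ν : E3) : facetArea F ν ≤ facetArea A ν + facetArea B ν := by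
  have h := facetArea_le_sum_of_subset_iUnion (Finset.univ : Finset Bool) F (fun b => cond b A B) ν ?_ ?_
  · simpa [Fintype.sum_bool] using h
  · intro x hx
    rcases hF hx with h | h
    · exact mem_iUnion₂.2 ⟨true, Finset.mem_univ _, h⟩
    · exact mem_iUnion₂.2 ⟨false, Finset.mem_univ _, h⟩
  · intro b _
    cases b
    · exact volume_prism_ne_top_of_isBounded hQ _ hB ν
    · exact volume_prism_ne_top_of_isBounded hQ _ hA ν

/-- **(W) the wall pair bound.**  For an origin-symmetric compact convex body `D ∋ 0` and disjoint pieces `P = polytope H`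
(unit facet normals), `P' = polytope H'`:
`ι_D(P, P') ≤ Σ_{p ∈ H} h_D(p.1) · facetArea (cl P ∩ {⟪p.1,x⟫ = p.2} ∩ cl P') p.1`. -/
theorem iota_pair_le_facetSum {D : Set E3} (hD : IsCompact D) (hDc : Convex ℝ D)
    (hD0 : (0 : E3) ∈ D) (hDs : -D = D) {H H' : Finset (E3 × ℝ)} (hb : Bornology.IsBounded (polytope H))
    (hb' : Bornology.IsBounded (polytope H')) (hunit : ∀ p ∈ H, ‖p.1‖ = 1)
    (hd : Disjoint (polytope H) (polytope H')) :
    (per D (polytope H) + per D (polytope H') - per D (polytope H ∪ polytope H')) / 2 ≤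
      ∑ p ∈ H, supportFn D p.1 *
        facetArea (closure (polytope H) ∩ {x : E3 | ⟪p.1, x⟫_ℝ = p.2} ∩ closure (polytope H')) p.1 := by
  obtain ⟨ν, b, hν, hsep⟩ := exists_separating_plane hd
  rw [per_add_per_sub_per_union_pair hD hDc hD0 hb hb' hd hν hsep, supportFn_neg_of_neg_eq hDs,
    show (supportFn D ν + supportFn D ν) * facetArea (closure (polytope H) ∩ closure (polytope H')) ν / 2 =
      supportFn D ν * facetArea (closure (polytope H) ∩ closure (polytope H')) ν by ring]
  have hsub : facetArea (closure (polytope H) ∩ closure (polytope H')) ν ≤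
      ∑ p ∈ H, facetArea (closure (polytope H) ∩ {x : E3 | ⟪p.1, x⟫_ℝ = p.2} ∩ closure (polytope H')) ν :=
    facetArea_le_sum_of_subset_iUnion H (closure (polytope H) ∩ closure (polytope H'))
      (fun p => closure (polytope H) ∩ {x : E3 | ⟪p.1, x⟫_ℝ = p.2} ∩ closure (polytope H')) ν
      (closure_inter_closure_subset_facets hd)
      (fun p _ => volume_prism_ne_top_of_isBounded hb _ (fun x hx => hx.1.1) ν)
  calc supportFn D ν * facetArea (closure (polytope H) ∩ closure (polytope H')) ν
      ≤ supportFn D ν * ∑ p ∈ H, facetArea (closure (polytope H) ∩ {x : E3 | ⟪p.1, x⟫_ℝ = p.2} ∩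
          closure (polytope H')) ν := mul_le_mul_of_nonneg_left hsub (supportFn_nonneg hD hD0 ν)
    _ = ∑ p ∈ H, supportFn D ν * facetArea (closure (polytope H) ∩ {x : E3 | ⟪p.1, x⟫_ℝ = p.2} ∩
          closure (polytope H')) ν := Finset.mul_sum _ _ _
    _ ≤ ∑ p ∈ H, supportFn D p.1 * facetArea (closure (polytope H) ∩ {x : E3 | ⟪p.1, x⟫_ℝ = p.2} ∩
          closure (polytope H')) p.1 := Finset.sum_le_sum fun p hp => ?_
  by_cases hpl : {x : E3 | ⟪ν, x⟫_ℝ = b} = {x : E3 | ⟪p.1, x⟫_ℝ = p.2}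
  · rcases eq_or_eq_neg_of_plane_eq hν (hunit p hp) hpl with h | h
    · rw [h]
    · rw [h, supportFn_neg_of_neg_eq hDs, facetArea_neg]
  · have h0 : facetArea (closure (polytope H) ∩ {x : E3 | ⟪p.1, x⟫_ℝ = p.2} ∩ closure (polytope H')) ν = 0 :=
      facetArea_eq_zero_of_subset_two_planes (π := p) hν (hunit p hp)
        (fun x hx => ⟨hsep ⟨hx.1.1, hx.2⟩, hx.1.2⟩) hpl
    rw [h0, mul_zero]
    exact mul_nonneg (supportFn_nonneg hD hD0 _) (facetArea_nonneg _ _)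

/-- **(F) the free pair bound.**  For an origin-symmetric compact convex body `K ∋ 0`, a piece `P = polytope H` with unit facet normals and
pairwise distinct facet planes, and a disjoint piece `P' = polytope H'`:
`Σ_{p ∈ H} h_K(p.1) · facetArea (cl P ∩ {⟪p.1,x⟫ = p.2} ∩ cl P') p.1 ≤ ι_K(P, P')` — the covered part of the facets of `P` is subtracted
in full by the interface term. -/
theorem facetSum_le_iota_pair {K : Set E3} (hK : IsCompact K) (hKc : Convex ℝ K)
    (hK0 : (0 : E3) ∈ K) (hKs : -K = K) {H H' : Finset (E3 × ℝ)} (hb : Bornology.IsBounded (polytope H))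
    (hb' : Bornology.IsBounded (polytope H')) (hunit : ∀ p ∈ H, ‖p.1‖ = 1)
    (hplanes : ∀ p ∈ H, ∀ p' ∈ H, p ≠ p' → {x : E3 | ⟪p.1, x⟫_ℝ = p.2} ≠ {x : E3 | ⟪p'.1, x⟫_ℝ = p'.2})
    (hd : Disjoint (polytope H) (polytope H')) :
    ∑ p ∈ H, supportFn K p.1 *
        facetArea (closure (polytope H) ∩ {x : E3 | ⟪p.1, x⟫_ℝ = p.2} ∩ closure (polytope H')) p.1 ≤
      (per K (polytope H) + per K (polytope H') - per K (polytope H ∪ polytope H')) / 2 := by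
  obtain ⟨ν, b, hν, hsep⟩ := exists_separating_plane hd
  rw [per_add_per_sub_per_union_pair hK hKc hK0 hb hb' hd hν hsep, supportFn_neg_of_neg_eq hKs,
    show (supportFn K ν + supportFn K ν) * facetArea (closure (polytope H) ∩ closure (polytope H')) ν / 2 =
      supportFn K ν * facetArea (closure (polytope H) ∩ closure (polytope H')) ν by ring]
  have hT0 : 0 ≤ supportFn K ν * facetArea (closure (polytope H) ∩ closure (polytope H')) ν :=
    mul_nonneg (supportFn_nonneg hK hK0 _) (facetArea_nonneg _ _)
  have hzero : ∀ p ∈ H, {x : E3 | ⟪ν, x⟫_ℝ = b} ≠ {x : E3 | ⟪p.1, x⟫_ℝ = p.2} →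
      supportFn K p.1 * facetArea (closure (polytope H) ∩ {x : E3 | ⟪p.1, x⟫_ℝ = p.2} ∩
        closure (polytope H')) p.1 = 0 := by
    intro p hp hne
    rw [facetArea_eq_zero_of_subset_two_planes (ν := p.1) (β := p.2) (π := (ν, b)) (hunit p hp) hν
      (fun x hx => ⟨hx.1.2, hsep ⟨hx.1.1, hx.2⟩⟩) (Ne.symm hne), mul_zero]
  by_cases hex : ∃ p ∈ H, {x : E3 | ⟪ν, x⟫_ℝ = b} = {x : E3 | ⟪p.1, x⟫_ℝ = p.2}
  · obtain ⟨p₀, hp₀, hpl⟩ := hex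
    rw [Finset.sum_eq_single_of_mem p₀ hp₀ (fun p hp hne => hzero p hp (fun h =>
      hplanes p hp p₀ hp₀ hne (h.symm.trans hpl)))]
    have hmono : facetArea (closure (polytope H) ∩ {x : E3 | ⟪p₀.1, x⟫_ℝ = p₀.2} ∩ closure (polytope H')) ν ≤
        facetArea (closure (polytope H) ∩ closure (polytope H')) ν := by
      have h := facetArea_le_sum_of_subset_iUnion ({0} : Finset (Fin 1))
        (closure (polytope H) ∩ {x : E3 | ⟪p₀.1, x⟫_ℝ = p₀.2} ∩ closure (polytope H'))
        (fun _ => closure (polytope H) ∩ closure (polytope H')) ν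
        (fun x hx => mem_iUnion₂.2 ⟨0, Finset.mem_singleton_self _, hx.1.1, hx.2⟩)
        (fun _ _ => volume_prism_ne_top_of_isBounded hb _ (fun x hx => hx.1) ν)
      rwa [Finset.sum_singleton] at h
    have hsf : supportFn K p₀.1 = supportFn K ν := by
      rcases eq_or_eq_neg_of_plane_eq hν (hunit p₀ hp₀) hpl with h | h
      · rw [h]
      · rw [h, supportFn_neg_of_neg_eq hKs]
    have hfa : facetArea (closure (polytope H) ∩ {x : E3 | ⟪p₀.1, x⟫_ℝ = p₀.2} ∩ closure (polytope H')) p₀.1 =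
        facetArea (closure (polytope H) ∩ {x : E3 | ⟪p₀.1, x⟫_ℝ = p₀.2} ∩ closure (polytope H')) ν := by
      rcases eq_or_eq_neg_of_plane_eq hν (hunit p₀ hp₀) hpl with h | h
      · rw [h]
      · rw [h, facetArea_neg]
    rw [hsf, hfa]
    exact mul_le_mul_of_nonneg_left hmono (supportFn_nonneg hK hK0 _)
  · simp only [not_exists, not_and] at hex
    rw [Finset.sum_eq_zero (fun p hp => hzero p hp (hex p hp))]
    exact hT0

end Summit.Ventures.Crystal3D.Cruxes.TextureLiminf.TexShadow

end
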